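import Literature.NumberTheory.LFunctions.Zhang2022.KnifeEdgeLambdaOverhang
import Literature.NumberTheory.LFunctions.Zhang2022.RepairLambdaBlock

/-!
# Zhang (2022) §18-margin repair rung, programme F-S3 §E (cell landau-siegel, barrier extension, stub S-E-bt1-1;
# 𝒟_len intake row (L-b)∣Λ): the `R⁺⁺` family «Λχψ-type coefficients on an OVERHANG piece `[1, θ]`, `θ > 1`» —
# the EXACT criterion of the Λ-overhang block, `familyLambdaOverhang K X`, `familyLambdaOverhangAll`, the graded
# twin `familyLambdaGradedAll`, and the §E wrap of registry rows E-070 / E-071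

Y. Zhang, *Discrete mean estimates and the Landau–Siegel zero*, arXiv:2211.02515v1 [Zhang2022LandauSiegel] —
an unrefereed manuscript under adjudication. **WHAT THIS IS NOT: not a claim about Theorems 1–2 of
arXiv:2211.02515, about Landau–Siegel zeros, about a repaired `Margin232`, or about Parity; nothing here asserts
any claim of the manuscript or any estimate. The programme SEARCHES and TYPES; no claim until a kernel theorem
says so.** The §E WRAP of the B-len typer's model of registry rows E-070 «E-len-main(Λ,θ)» ⊕ E-071
«E-len-offdiag(Λ,θ)» — `KnifeEdgeLambdaOverhang` (p461166 + p462691: `KnifeEdge.LambdaPiece.Overhang θ L v′`, the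
dictionary `ELambdaOverhang c' θ K X Λs`, the decision `ELambdaOverhangCloses θ K X`, the displayed slots
`LambdaOverhangDiagNonneg θ K` / `LambdaOverhangCS θ K X`, the one-way certificates `not_eLambdaOverhangCloses_of_cs`
/ `eLambdaOverhangCloses_of_indefinite`, the price `LambdaCrossBounded` / `not_closes_of_crossBounded`, the graded
twin `ELambdaOverhangGraded` / `LambdaGradedClosesAtFloor`, the Montgomery–Vaughan taper witness) — into the extension
protocol of `RepairRplus` (p455670: `Repair.DesignFamily`, `Repair.rplus_extend`), in EXACTLY the shape of
`Repair.familyLambdaBlock` / `familyLambdaBlockAll` (RepairLambdaBlock, the IN-LENGTH Λ-block of B-multi's M2, tops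
`≤ 1`), whose pencil algebra (`lambdaBlockMainTerm_eq_twoBlockPencil`, `twoBlockPencil_exists_neg_of_neg`, the
saturating world) is CITED, not re-typed. Nothing of p461166 / p462691 is re-typed.

**C1 — the class (KILL word of record).** B-len was KILLED: of-record line ls-lead, cell STATUS 2026-08-26T19:19:33Z,
under director-frontier pre-authorisation 18:53:49Z («§B-len KILL — OF RECORD … KILL-draft v2.4 b46628540b6b957c §1
«KILL(B-len) INSIDE 𝒟_len GIVEN B-AH (E-014)» with the E-085 (c)-door cited … candidates 0 of 189, no number
load-bearing … family B-len DIES INTO §E — KILL-INTAKE fold by ls-barrier-plan (hand-over: `RepairLengthsIndependent`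
p463543 (L-a), class-slot families (L-b), RepairIntakeBlen …)»); countersignature ls-B-ref-1 (REF-B1) 19:15:24Z over
v2.3 23f7f953463b7ce2, covering v2.4 (§2 class block unchanged); intake of record `Repair.blenWord` / `familyBlen`
(RepairIntakeBlen p465008, (L-b) declared partial → `blenWord2`). PREMISE OF THE WORD, BY NAME: «GIVEN B-AH (E-014,
GLOBAL form — exact Cauchy–Schwarz / positivity persists in the completed ⟨A⟩-world calculus of the class)». **The
family theorems below do not use B-AH; it is the premise for reading the displayed slots as (A)-world properties**
(the CS slot `LambdaOverhangCS` IS the B-AH prediction for this class; its failure is the (c)-door, registry row E-085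
«non-model main-order entry», open, used in no word). The sub-class text, VERBATIM (B-len/KILL-draft.md v2.4 §2):
«(L-b) arithmetic coefficient
classes on an OVERHANG piece [1, θ] (or whole profile [0, θ]) glued to an in-class bulk: Λχψ-type a(n) =
χψ(n)·(Λ^{∗k}/log^k P)(n)·v(z_n), k ≤ 2 (S1-Λ; rows E-070/E-071); …», inside the common box «finitely many PPE(ℚ[i])
pieces … on rational supports ⊂ [0, 2], of which AT LEAST ONE has top θ ∈ (1, 2) (wall R-b crossed: ν₁ = θ > 1) …
endgame ∈ {POS (fixed amplitudes), CS (free ι)} … family = Zhang's PRIME family ψ mod p, p ∼ P», and the Λ clause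
of the KILL sentence (§1, verbatim): «(Λχψ) a SIGN/PSD statement about the class off-diagonal main term — «X_Λ fails
CompletedCS: ∃ v, K_Λ(v) + 2Re X_Λ(v,v) < 0 or |X_Λ(u,v)|² > 𝔅(u)(K_Λ(v) + 2Re X_Λ(v,v))» (E-071 with sign,
XL-substantive by RANGE: primes at length p^θ to prime moduli p) — because the class diagonal K_Λ ≥ 0 (E-070, PNT
rule, S) makes Cstar = 0 and the required strength Creq ≤ K/(2N_θ²) → 0 (§5), so C-boundedness is no protection and
only the SIGN decides». Members of record (B-len/designs/BATCH-1v2.json c516b3bb5a4103db, BATCH-3.json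
7e2b17898a96282a; DESIGN-MAP-len.md v0.8 466a1df1b6d1231c): the 48 `len-lam-{bump,front,back,rampcut}-u{52,32}-th*`
rows = bulk `ϰ(1,5/2)` or `ϰ(1,3/2)` ⊕ a POLYNOMIAL Λ-profile on `[1,θ]`, `θ ∈ {21/20, 11/10, 5/4}` (+ F-flat
companions `81/80, 41/40, 17/16`), and the 6 kernel-mode rows `len-lam-gstar-mv-th*` = `g⋆ ⊕ c·MV-taper(θ)`.
Lean class = `Repair.LambdaOverhangDesign.InClass`: `Repair.KinkedProfile u u′` ∧ `u 1 = 0` ∧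
`L.Overhang d.θ v′` (p461166's binders verbatim; `1 < θ` and `k ≥ 1` are inside `Overhang`). DECLARED DIFFERENCES
(none silent): (i) WIDER — any `θ > 1` (the word: `θ ∈ (1,2)`; knots `≤ 5/4` evaluated = narrowing n-len-3, carried,
not claimed as numerics), any convolution order `k ≥ 1` (the word: `k ≤ 2`), any bounded profile continuous on `[1,θ]`
with an `L²` marked derivative (the word: PPE(ℚ[i]) — every polynomial piece on `[1,θ]` is a member,
`overhang_polyPiece`), any amplitude `c ∈ ℂ`; (ii) NARROWER, uncovered part listed — the word's parenthesis «(or whole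
profile [0, θ])»: a ONE-piece Λχψ profile on `[0,θ]` straddling the wall is NOT a member (the class profile is zero
below the wall); read as two Λ-pieces (in-length block `top ≤ 1` ∈ B-multi's M2 `Repair.familyLambdaBlockAll`, E-14,
plus the overhang ∈ this family) it is a THREE-block mixed member (bulk `u`, Λ-in, Λ-out) — the Gram-family shape,
NOT claimed here; no design of record has this shape (all 54 `len-lam-*` rows are `supp [1,θ]`); (iii) the in-class
side is ONE kinked continuous `H¹` profile on `[0,1]` with `u(1) = 0` — every free-`ι` sum of `ϰ`-pieces with tops
`≤ 1` and the kernel mode `g⋆` are such (kinked profiles form a subspace, `Repair.KinkedProfile.add_smul`), but NOT a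
bulk with wall value `u(1⁻) ≠ 0` or interior jumps (𝒟_multi coordinates, KILLED 18:10:26Z into `RepairIntakeBmulti`),
nor a design with TWO Λ-pieces read as three blocks (one Λ-piece per design here); (iv) the μψ and νψ clauses of (L-b)
are NOT this file (S-E-bt2-1 `RepairBlenMuNu` over `KnifeEdgeMuPsiOverhang` p458584 / `KnifeEdgeNuOverhang` p461177);
the narrowings n-len-1 (general bounded `a(n)` = STATEMENT ONLY — no family may claim it), n-len-2 (L13 composite
family = ceiling/enabler only), n-len-3 are carried verbatim and NOT claimed.

| family (this file) | sub-class of 𝒟_len | currency | displayed slots (kind (c), WORLD binders) | flag |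
|---|---|---|---|---|
| `familyLambdaOverhangAll` (+ per-world `familyLambdaOverhang K X`) | (L-b)∣Λ, k ≥ 1, overhang `[1,θ]`, θ > 1 | MODEL (E-070 diagonal sign, S-derivation; E-071 SIGN/PSD, XL = E*-len strength) | `LambdaOverhangDiagNonneg θ K` (E-070) ∧ `LambdaOverhangCS θ K X` (E-071) — diagonal redundant given CS (`lambdaOverhangDiagNonneg_of_cs`) | CONDITIONAL «closing excluded GIVEN B-AH (E-014)»: the CS slot is the B-AH prediction; threshold `lambdaOverhangNull_iff`; (c)-door = `LambdaOverhangIndefinite` (E-085) |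
| `familyLambdaGradedAll` | same class, GRADED currency (fixed amplitude, `𝔞`-graded cross, p462691) | MODEL | `LambdaOverhangDiagNonneg θ K` ∧ `LambdaGradedCS θ K G` | CONDITIONAL «GIVEN B-AH (E-014)» (graded CS = the PSD of the graded block) |

**C3 — currency and displayed slots (REF-E C3/C3(e)).** MODEL currency of rows E-070/E-071 (= E-030's, beyond the
wall): the verdict is about the model constant `lambdaBlockMainTerm K X u u′ L c = 𝔅(u) + 2Re(κ_×(u,L)c) + |c|²K(L)`
in a parameter world `(K, X)` at the design's top `θ` (balanced-amplitude reading at scale `Λ_s`; derivation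
in-house, NOT carried out — E-070 status «derivation, weight `w` underived, HEURISTIC», E-071 «open-in-print,
XL-substantive»). That the (A)-world main term of a Λ-overhang design IS such a block for some `(K, X)` is the
dictionary `ELambdaOverhang` itself — open, not claimed. Displayed slots, kind (c), never folded into the class:
`LambdaOverhangDiagNonneg θ K` (E-070 sign `+`; PROVED for every explicit candidate `lambdaOverhangDiag θ w`, `w ≥ 0`,
and `lambdaOverhangDiagH1 θ w₀ w₁`) and `LambdaOverhangCS θ K X` (E-071 in (B1) form = the word's «GIVEN B-AH
(E-014)» clause). Their failure on a member = `LambdaOverhangIndefinite θ K X` = the KILL sentence's «X_Λ fails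
CompletedCS» = the (c)-door E-085; by `KnifeEdge.theorem1_of_eLambdaOverhang_indefinite` an indefinite block that IS
the main term would already give Theorem 1. GRADED currency (Part 3): at FIXED amplitude with an `𝔞`-graded cross
`G : ℝ → LambdaCross` the block at coupling value `𝔞` is `[[𝔅(u)𝔞, G 𝔞],[·, K(L)]]`; displayed slot
`LambdaGradedCS θ K G` (its CS inequality at every `𝔞 > 0`) — the KILL-draft §6 «§E target shape ∀ d ∈ 𝒟_len∣Λ,
CompletedCS-type PSD of the graded block ⇒ ¬closes». **«Only the SIGN decides»** (the word's §1/§5) is carried as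
THEOREMS, never folded into the class: `Cstar = 0` on the whole class is p461166's `not_eLambdaOverhangCloses_zero` +
`lambdaCrossBounded_zero` (the input `X = 0` is `C`-bounded for every `C ≥ 0` and never closes); the per-design
required strength is the kernel sentence `KnifeEdge.not_closes_of_crossBounded` (`Creq_offdiag(d) = √(𝔅(u)K(L))/
(N₁N_θ)`; the census values `Creq_λ ∈ [0.0003136, 0.02811]` on the 48 polynomial rows and `∋ 0` on the 6 kernel-mode
rows are DESIGN-MAP-len v0.8 data — a DECLARED PRICE, no number enters a statement); and in kernel form «only the sign
decides» is exactly `eLambdaOverhangCloses_iff_indefinite` below (closing ⟺ the derived block violates CS on a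
member, whatever its size).

**Contents.** Part 1 — THE EXACT CRITERION of the Λ-overhang block (new; p461166 has the two one-way halves):
`lambdaOverhangNull_iff : LambdaOverhangNull θ K X ↔ LambdaOverhangDiagNonneg θ K ∧ LambdaOverhangCS θ K X`
(Sylvester `n = 2`, `KnifeEdge.twoBlockPencil_nonneg_iff` p458738), `lambdaOverhangDiagNonneg_of_cs` (the diagonal
slot FOLLOWS from the CS slot, tested on `ϰ_{1,5/2}`, `KnifeEdge.mainTermForm_kappaP_one_pos`), hence
`lambdaOverhangNull_iff_cs` and **`eLambdaOverhangCloses_iff_indefinite : ELambdaOverhangCloses θ K X ↔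
LambdaOverhangIndefinite θ K X`** — in the model world the (L-b)∣Λ class closes by positivity IFF the derived block is
indefinite on a member: the (c)-door is the ONLY door, with no sign hypothesis on `K`; on a kernel mode (`𝔅(u) = 0`,
`g⋆`) the CS slot forces the coupling to VANISH (`lambdaOverhangCross_eq_zero_of_kernelMode`) and conversely ANY
nonzero coupling with `K(L) > 0` closes (`eLambdaOverhangCloses_of_kernelMode`) — the kernel form of the certified
«Creq_λ ∋ 0, closes as soon as κ_×(g⋆,L) ≠ 0» rows of BATCH-3 (DESIGN-MAP-len v0.8 data). Part 2 — the families: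
`LambdaOverhangDesign` (θ, u, u′, L, v′, c) / `.InClass`, `familyLambdaOverhang K X` (Verdict
`LambdaOverhangDiagNonneg d.θ K → LambdaOverhangCS d.θ K X → ¬ (lambdaBlockMainTerm K X u u′ L c < 0)`),
`familyLambdaOverhang_decided`, `rplus_lambdaOverhang_decided`; the CLOSED term `familyLambdaOverhangAll` (worlds
quantified inside the Verdict) with `familyLambdaOverhangAll_iff`, `_decided`, `rplus_lambdaOverhangAll_decided`,
unbundled `not_repairable_lambdaOverhang`, the class-level reading `familyLambdaOverhangAll_decided_iff_not_closes`
(decided ⟺ `∀ θ K X, LambdaOverhangDiagNonneg θ K → LambdaOverhangCS θ K X → ¬ ELambdaOverhangCloses θ K X`,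
p461166's `not_eLambdaOverhangCloses_of_cs` sentence) and the per-top exactness `lambdaOverhang_null_iff_cs` (all
members of top `θ` satisfy the verdict's conclusion in the world `(K,X)` iff the CS slot holds at `θ`). Part 3 — the GRADED twin:
`lambdaGradedMainTerm_eq_twoBlockPencil`, slot `LambdaGradedCS θ K G`, `lambdaGradedMainTerm_nonneg_of_cs`,
`not_lambdaGradedClosesAtFloor_of_cs` (at ANY floor), `familyLambdaGradedAll` / `_decided` /
`rplus_lambdaGradedAll_decided`; the graded slot is inhabited (`lambdaGradedCS_zero`) and load-bearing (the affine
world `G 𝔞 = 𝔞•X₁`, `X₁ ≡ −(𝔅(u)+1)`, closes at every positive floor on every member with `K ≡ 0`: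
`lambdaGradedCross_slot_loadBearing`, via p462691's `lambdaGradedClosesAtFloor_of_affine`). Part 4 — C2: at amplitude
`c = 0` the member is its in-class profile alone and the verdict is `R̄`'s positivity UNCONDITIONALLY
(E-14's `Repair.lambdaBlock_verdict_zero`, cited; `familyLambdaOverhangAll_verdict_of_amplitude_zero`: the closed family's verdict at `c = 0` needs neither slot nor `u(1) = 0` nor the overhang shape); the class is DISJOINT from M2 (`not_admissible_of_overhang`: `top ≤ 1` vs
`top = θ > 1`) while the pencil is the same function; C4: the members of record as DATA — every polynomial piece on
`[1,θ]` is an overhang piece (`polyPiece`, `overhang_polyPiece`), the bump of record `bumpPoly θ = 4t(1−t)`,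
`t = (z−1)/(θ−1)` (`lenLamBump θ k c`, in class for `θ > 1`, `0 < 1 ≤ 1`: `inClass_lenLamBump`), and the kernel-mode
member `lenLamGstarMV θ c = g⋆ ⊕ c·MV-taper(θ)` (`inClass_lenLamGstarMV`, `verdict_lenLamGstarMV`; its block value in
a CS world is `|c|²K ≥ 0` exactly: `lambdaBlockMainTerm_lenLamGstarMV_of_cs`). Part 5 — the slots are inhabited with
EQUALITY and load-bearing on the overhang class: `saturatingWorld_overhang_slots` (RepairLambdaBlock's `K ≡ 1`,
`κ_× = √𝔅(u)`; the pencil touches zero there, `Repair.lambdaBlockMainTerm_saturating_touch`), a negative diagonal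
closes in every cross world (`eLambdaOverhangCloses_of_negDiag`), and for EVERY member there is a world with
`K ≡ 1 > 0` in which it closes (`lambdaOverhangCross_slot_loadBearing`) — so the verdict cannot drop `LambdaOverhangCS`.
No numeric certificate is consumed; axioms standard. References: Zhang, arXiv:2211.02515v1, §2 (2.15)–(2.20),
(2.23)–(2.25), (2.27), (2.31), Lemma 2.3; §7 Prop 7.1 (7.2) p.44 [cite: Zhang2022LandauSiegel, §2 Lemma 2.3, §7 Prop
7.1 (7.2)]; R. Horn, C. Johnson, *Matrix Analysis* 2nd ed., Thm 7.2.5 [cite: HornJohnson2013, Thm 7.2.5]; cell files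
B-len/KILL-draft.md v2.4 §1/§2/§6, B-len/designs/INDEX.md, barrier/ASSIGNMENTS.md (S-E-p2-6 (L-b) rows),
ls-barrier-plan/COVERAGE.md row «B-len (L-b)». «The programme SEARCHES and TYPES; no claim about Landau–Siegel
zeros, Theorems 1–2 of arXiv:2211.02515 or a repaired Margin232 until a kernel theorem says so.»
-/

noncomputable section

open Complex Real Set
open _root_.MeasureTheory

namespace Literature.NumberTheory.LFunctions.Zhang2022

namespace Repair

open KnifeEdge

variable {θ : ℝ} {K : LambdaDiag} {X : LambdaCross} {u u' : ℝ → ℂ} {L : LambdaPiece} {v' : ℝ → ℂ}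

/-! ### Part 1 — the exact criterion of the Λ-OVERHANG block (model world `(K, X)` at top `θ`) -/

/-- **NULL of the model world `(K, X)` at top `θ`:** no member of the class (kinked in-class `u` with `u(1) = 0`,
Λ-piece overhanging to `θ`, any amplitude) has a negative model constant — the negation of p461166's
`ELambdaOverhangCloses θ K X` (`eLambdaOverhangCloses_iff_not_null`). Candidate shape, NOT asserted for any world.
[cite: Zhang2022LandauSiegel, §7 Prop 7.1 (7.2)] -/
def LambdaOverhangNull (θ : ℝ) (K : LambdaDiag) (X : LambdaCross) : Prop :=
  ∀ (u u' : ℝ → ℂ) (L : LambdaPiece) (v' : ℝ → ℂ) (c : ℂ), KinkedProfile u u' → u 1 = 0 → L.Overhang θ v' →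
    0 ≤ lambdaBlockMainTerm K X u u' L c

/-- **The EDGE-REPORT shape on the overhang class** (the KILL sentence's «X_Λ fails CompletedCS», (c)-door E-085):
the derived block is INDEFINITE on some member — `𝔅(u)·K(L) < |κ_×(u,L)|²`. [cite: Zhang2022LandauSiegel, §7 Prop 7.1 (7.2)] -/
def LambdaOverhangIndefinite (θ : ℝ) (K : LambdaDiag) (X : LambdaCross) : Prop :=
  ∃ (u u' : ℝ → ℂ) (L : LambdaPiece) (v' : ℝ → ℂ), KinkedProfile u u' ∧ u 1 = 0 ∧ L.Overhang θ v' ∧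
    mainTermForm u u' * K L < ‖X u u' L‖ ^ 2

/-- Closing is the failure of the null. [cite: Zhang2022LandauSiegel, §7 Prop 7.1 (7.2)] -/
theorem eLambdaOverhangCloses_iff_not_null : ELambdaOverhangCloses θ K X ↔ ¬ LambdaOverhangNull θ K X := by
  unfold ELambdaOverhangCloses LambdaOverhangNull
  push Not
  constructor
  · rintro ⟨u, u', L, v', c, hu, hu1, hL, h⟩
    exact ⟨u, u', L, v', c, hu, hu1, hL, h⟩
  · rintro ⟨u, u', L, v', c, hu, hu1, hL, h⟩
    exact ⟨u, u', L, v', c, hu, hu1, hL, h⟩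

/-- **A negative Λ-diagonal closes, in EVERY cross world:** if `K(L) < 0` on some piece overhanging to `θ`, the
member `0 ⊕ c·λ` (zero in-class profile) has a negative constant for a suitable amplitude
(`Repair.twoBlockPencil_exists_neg_of_neg`). [cite: Zhang2022LandauSiegel, §7 Prop 7.1 (7.2)] -/
theorem eLambdaOverhangCloses_of_negDiag (h : ∃ (L : LambdaPiece) (v' : ℝ → ℂ), L.Overhang θ v' ∧ K L < 0) :
    ELambdaOverhangCloses θ K X := by
  obtain ⟨L, v', hL, hneg⟩ := h
  obtain ⟨s, hs⟩ := twoBlockPencil_exists_neg_of_neg hneg (X (fun _ => (0:ℂ)) (fun _ => (0:ℂ)) L)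
    (mainTermForm (fun _ => (0:ℂ)) (fun _ => (0:ℂ)))
  refine ⟨fun _ => 0, fun _ => 0, L, v', s, kinkedProfile_zero, rfl, hL, ?_⟩
  rw [lambdaBlockMainTerm_eq_twoBlockPencil]
  exact hs

/-- **THE EXACT CRITERION of the Λ-overhang block (model world):** no member closes iff the diagonal is `≥ 0` on
the overhang class AND the coupling is Cauchy–Schwarz-subordinate — an iff with `≤`, covering the degenerate
amplitudes (`K(L) = 0` forces `κ_×(·,L) = 0`) and the in-class kernel modes `𝔅(u) = 0`. The (←) half is p461166's
certificate (`sq_sqrt_sub_le_lambdaBlockMainTerm`); (→) is Sylvester `n = 2` (`KnifeEdge.twoBlockPencil_nonneg_iff`,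
p458738) after `eLambdaOverhangCloses_of_negDiag` has produced the sign of `K`. [cite: HornJohnson2013, Thm 7.2.5] -/
theorem lambdaOverhangNull_iff :
    LambdaOverhangNull θ K X ↔ LambdaOverhangDiagNonneg θ K ∧ LambdaOverhangCS θ K X := by
  constructor
  · intro h
    have hK : LambdaOverhangDiagNonneg θ K := by
      intro L v' hL
      by_contra hneg
      push Not at hneg
      exact (eLambdaOverhangCloses_iff_not_null.1
        (eLambdaOverhangCloses_of_negDiag (X := X) ⟨L, v', hL, hneg⟩)) h
    refine ⟨hK, fun u u' L v' hu hu1 hL => ?_⟩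
    have hall : ∀ s : ℂ, 0 ≤ twoBlockPencil (K L) (X u u' L) (mainTermForm u u') s := fun s => by
      rw [← lambdaBlockMainTerm_eq_twoBlockPencil]
      exact h u u' L v' s hu hu1 hL
    have crit := (twoBlockPencil_nonneg_iff (hK L v' hL)).1 hall
    rw [mul_comm]
    exact crit.2
  · rintro ⟨hK, hX⟩ u u' L v' c hu hu1 hL
    have hB : 0 ≤ mainTermForm u u' := mainTermForm_nonneg_of_isH1 hu.isH1
    exact (sq_nonneg _).trans (sq_sqrt_sub_le_lambdaBlockMainTerm hB (hK L v' hL) (hX u u' L v' hu hu1 hL) c)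

/-- **The diagonal slot FOLLOWS from the CS slot:** testing `|κ_×(u₀,L)|² ≤ 𝔅(u₀)·K(L)` on the in-class piece
`u₀ = ϰ_{1,5/2}` (`𝔅(u₀) > 0`, `KnifeEdge.mainTermForm_kappaP_one_pos`) forces `K(L) ≥ 0` on every piece
overhanging to `θ` — so ONE displayed slot suffices for the (L-b)∣Λ verdict.
[cite: Zhang2022LandauSiegel, (2.23)–(2.25) p.9; §7 Prop 7.1 (7.2)] -/
theorem lambdaOverhangDiagNonneg_of_cs (hX : LambdaOverhangCS θ K X) : LambdaOverhangDiagNonneg θ K := by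
  intro L v' hL
  have h := hX (kappaP 1 (5/2)) (kappaP' 1 (5/2)) L v' (kinkedProfile_kappaP one_pos le_rfl)
    (kappaP_one one_pos le_rfl) hL
  have hpos := mainTermForm_kappaP_one_pos
  by_contra hneg
  push Not at hneg
  have hprod : mainTermForm (kappaP 1 (5/2)) (kappaP' 1 (5/2)) * K L < 0 := mul_neg_of_pos_of_neg hpos hneg
  have hsq := sq_nonneg ‖X (kappaP 1 (5/2)) (kappaP' 1 (5/2)) L‖
  linarith

/-- … hence the criterion with the single slot: **no member closes iff the coupling is CS-subordinate.**
[cite: HornJohnson2013, Thm 7.2.5] -/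
theorem lambdaOverhangNull_iff_cs : LambdaOverhangNull θ K X ↔ LambdaOverhangCS θ K X :=
  ⟨fun h => (lambdaOverhangNull_iff.1 h).2, fun h => lambdaOverhangNull_iff.2 ⟨lambdaOverhangDiagNonneg_of_cs h, h⟩⟩

/-- An indefinite block is NOT Cauchy–Schwarz-subordinate on the overhang class: the edge report negates the (B1)
claim on that member. [cite: Zhang2022LandauSiegel, §2 Lemma 2.3, (2.15)] -/
theorem lambdaOverhangIndefinite_not_cs (h : LambdaOverhangIndefinite θ K X) : ¬ LambdaOverhangCS θ K X := by
  obtain ⟨u, u', L, v', hu, hu1, hL, hind⟩ := h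
  intro hcs
  exact not_lt.2 (hcs u u' L v' hu hu1 hL) hind

/-- **THE ONLY DOOR: the (L-b)∣Λ model closes iff the derived block is INDEFINITE on some member** — the KILL
sentence's «X_Λ fails CompletedCS» (registry E-085) is exactly the closing criterion, with NO sign hypothesis on `K`
(p461166's `eLambdaOverhangCloses_of_indefinite` needed `K(L) > 0`; a negative `K(L)` already violates CS at
`ϰ_{1,5/2}`). [cite: Zhang2022LandauSiegel, §7 Prop 7.1 (7.2)] -/
theorem eLambdaOverhangCloses_iff_indefinite : ELambdaOverhangCloses θ K X ↔ LambdaOverhangIndefinite θ K X := by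
  rw [eLambdaOverhangCloses_iff_not_null, lambdaOverhangNull_iff_cs]
  constructor
  · intro h
    unfold LambdaOverhangCS at h
    push Not at h
    obtain ⟨u, u', L, v', hu, hu1, hL, hlt⟩ := h
    exact ⟨u, u', L, v', hu, hu1, hL, hlt⟩
  · exact lambdaOverhangIndefinite_not_cs

/-- On an in-class KERNEL MODE (`𝔅(u) = 0`, e.g. `g⋆`: `Repair.mainTermForm_gStar`) the CS slot forces the
Λ-coupling to VANISH. [cite: HornJohnson2013, Thm 7.2.5] -/
theorem lambdaOverhangCross_eq_zero_of_kernelMode (hX : LambdaOverhangCS θ K X) (hu : KinkedProfile u u')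
    (hu1 : u 1 = 0) (hL : L.Overhang θ v') (h0 : mainTermForm u u' = 0) : X u u' L = 0 := by
  have h := hX u u' L v' hu hu1 hL
  rw [h0, zero_mul] at h
  exact norm_eq_zero.1 (pow_eq_zero_iff two_ne_zero |>.1 (le_antisymm h (sq_nonneg _)))

/-- **Kernel-mode tightness («Creq = 0⁺»):** on a kernel mode (`𝔅(u) = 0`) with `K(L) > 0`, ANY nonzero coupling
makes the block indefinite, so the class closes (`eLambdaOverhangCloses_of_indefinite`) — the kernel form of the
BATCH-3 rows `len-lam-gstar-mv-th*` of DESIGN-MAP-len v0.8 («Creq_λ ∋ 0: closes as soon as κ_×(g⋆,L) ≠ 0»; data,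
no number enters the statement).
[cite: Zhang2022LandauSiegel, §7 Prop 7.1 (7.2)] -/
theorem eLambdaOverhangCloses_of_kernelMode (hu : KinkedProfile u u') (hu1 : u 1 = 0) (hL : L.Overhang θ v')
    (hK : 0 < K L) (h0 : mainTermForm u u' = 0) (hx : X u u' L ≠ 0) : ELambdaOverhangCloses θ K X :=
  eLambdaOverhangCloses_of_indefinite hu hu1 hL hK (by
    rw [h0, zero_mul]
    exact pow_pos (norm_pos_iff.2 hx) 2)

/-! ### Part 2 — the families for the extension protocol of `RepairRplus` -/

/-- **A design of sub-class (L-b)∣Λ:** the top `θ` of the overhang, a side-1 in-class profile `u` (marked right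
derivative `u′`), ONE Λ-type piece `L` (order `k`, top `θ`, profile) with the marked derivative `v′` of its profile on
`(1,θ)`, and the balanced amplitude `c` — the realised value table is p459168's `lambdaDesign χ u L c Λ_s`.
[cite: Zhang2022LandauSiegel, §2 (2.23)–(2.25), (2.27); §7 (7.2)] -/
structure LambdaOverhangDesign where
  /-- the logarithmic top `θ` of the Λ-piece (`n ≤ P^θ`) -/
  θ : ℝ
  /-- the in-class `χψ`-smooth side-1 profile -/
  u : ℝ → ℂ
  /-- its marked right derivative -/
  u' : ℝ → ℂ
  /-- the Λ-type piece (order, top, profile) -/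
  L : LambdaPiece
  /-- the marked right derivative of the Λ-profile on `(1, θ)` -/
  v' : ℝ → ℂ
  /-- the balanced amplitude of the Λ-piece -/
  c : ℂ

/-- **Membership in (L-b)∣Λ** (p461166's binders verbatim; NO analytic hypothesis inside): `u` a kinked `H¹` profile
on `[0,1]` with `u(1) = 0`, `L` overhanging to `θ` (`k ≥ 1`, `top = θ > 1`, profile continuous on `[1,θ]` with an
`L²` marked derivative, zero below the wall, bounded). [cite: Zhang2022LandauSiegel, §7 (7.2)] -/
structure LambdaOverhangDesign.InClass (d : LambdaOverhangDesign) : Prop where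
  kinked : KinkedProfile d.u d.u'
  wall : d.u 1 = 0
  ovh : d.L.Overhang d.θ d.v'

/-- A member's top is beyond the wall. [cite: Zhang2022LandauSiegel, §7 (7.2)] -/
theorem LambdaOverhangDesign.InClass.one_lt {d : LambdaOverhangDesign} (hd : d.InClass) : 1 < d.θ :=
  hd.ovh.one_lt

/-- **The family «(L-b)∣Λ overhang block in the model world `(K, X)`»**: verdict = with the two DISPLAYED slots at
the design's top, `LambdaOverhangDiagNonneg d.θ K` (E-070, `K ≥ 0`) and `LambdaOverhangCS d.θ K X` (E-071 in (B1)
form = «GIVEN B-AH»), the member's model constant is not negative. [cite: Zhang2022LandauSiegel, §7 Prop 7.1 (7.2)] -/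
def familyLambdaOverhang (K : LambdaDiag) (X : LambdaCross) : DesignFamily where
  Design := LambdaOverhangDesign
  InClass d := d.InClass
  Verdict d := LambdaOverhangDiagNonneg d.θ K → LambdaOverhangCS d.θ K X →
    ¬ (lambdaBlockMainTerm K X d.u d.u' d.L d.c < 0)

/-- **The (L-b)∣Λ family is decided in every model world** (by the (←) half of `lambdaOverhangNull_iff`, i.e.
p461166's certificate). [cite: Zhang2022LandauSiegel, §7 Prop 7.1 (7.2)] -/
theorem familyLambdaOverhang_decided (K : LambdaDiag) (X : LambdaCross) : (familyLambdaOverhang K X).Decided :=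
  fun d hd hK hX => not_lt.2 (lambdaOverhangNull_iff.2 ⟨hK, hX⟩ d.u d.u' d.L d.v' d.c hd.kinked hd.wall hd.ovh)

/-- In fact the CS slot alone gives the verdict (`lambdaOverhangDiagNonneg_of_cs`). [cite: Zhang2022LandauSiegel, §7 Prop 7.1 (7.2)] -/
theorem familyLambdaOverhang_verdict_of_cs {d : LambdaOverhangDesign} (hX : LambdaOverhangCS d.θ K X)
    (hd : d.InClass) : ¬ (lambdaBlockMainTerm K X d.u d.u' d.L d.c < 0) :=
  familyLambdaOverhang_decided K X d hd (lambdaOverhangDiagNonneg_of_cs hX) hX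

/-- **Per-top EXACTNESS of the slot:** in the world `(K, X)`, every member of top `θ` has a non-negative model
constant IFF the CS slot holds at `θ` — the displayed slot is the threshold, not a convenience.
[cite: HornJohnson2013, Thm 7.2.5] -/
theorem lambdaOverhang_null_iff_cs (θ : ℝ) (K : LambdaDiag) (X : LambdaCross) :
    (∀ d : LambdaOverhangDesign, d.InClass → d.θ = θ → 0 ≤ lambdaBlockMainTerm K X d.u d.u' d.L d.c) ↔
      LambdaOverhangCS θ K X := by
  rw [← lambdaOverhangNull_iff_cs]
  constructor
  · intro h u u' L v' c hu hu1 hL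
    exact h ⟨θ, u, u', L, v', c⟩ ⟨hu, hu1, hL⟩ rfl
  · rintro h d hd rfl
    exact h d.u d.u' d.L d.v' d.c hd.kinked hd.wall hd.ovh

/-- **`R⁺ ++ [(L-b)∣Λ in the world (K, X)]` is decided** (`Repair.rplus_extend`).
[cite: Zhang2022LandauSiegel, §2 (2.32)–(2.33); §7 Prop 7.1 (7.2)] -/
theorem rplus_lambdaOverhang_decided (K : LambdaDiag) (X : LambdaCross) :
    ClassDecided (Rplus ++ [familyLambdaOverhang K X]) :=
  rplus_extend (familyLambdaOverhang_decided K X)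

/-- **The CLOSED family «(L-b)∣Λ, all model worlds»** (the member the running assembly / `RepairIntakeBlen`
appends; worlds quantified inside the verdict, the shape of `Repair.familyLambdaBlockAll`): verdict = in EVERY world
`(K, X)` carrying the two displayed slots at the design's top, the member's model constant is not negative.
[cite: Zhang2022LandauSiegel, §7 Prop 7.1 (7.2)] -/
def familyLambdaOverhangAll : DesignFamily where
  Design := LambdaOverhangDesign
  InClass d := d.InClass
  Verdict d := ∀ (K : LambdaDiag) (X : LambdaCross), LambdaOverhangDiagNonneg d.θ K → LambdaOverhangCS d.θ K X →
    ¬ (lambdaBlockMainTerm K X d.u d.u' d.L d.c < 0)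

/-- Membership / verdict of the closed family versus the world-parametric one: same class; the closed verdict is the
conjunction over all worlds. [cite: Zhang2022LandauSiegel, §7 Prop 7.1 (7.2)] -/
theorem familyLambdaOverhangAll_iff (d : LambdaOverhangDesign) :
    (familyLambdaOverhangAll.InClass d ↔
        ∀ (K : LambdaDiag) (X : LambdaCross), (familyLambdaOverhang K X).InClass d) ∧
      (familyLambdaOverhangAll.Verdict d ↔
        ∀ (K : LambdaDiag) (X : LambdaCross), (familyLambdaOverhang K X).Verdict d) :=
  ⟨⟨fun h _ _ => h, fun h => h (fun _ => 0) (fun _ _ _ => 0)⟩, Iff.rfl⟩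

/-- The closed family is decided iff every world-parametric family is. [cite: Zhang2022LandauSiegel, §7 Prop 7.1 (7.2)] -/
theorem familyLambdaOverhangAll_decided_iff :
    familyLambdaOverhangAll.Decided ↔
      ∀ (K : LambdaDiag) (X : LambdaCross), (familyLambdaOverhang K X).Decided :=
  ⟨fun h K X d hd => h d hd K X, fun h d hd K X => h K X d hd⟩

/-- **The closed (L-b)∣Λ family is decided.** [cite: Zhang2022LandauSiegel, §7 Prop 7.1 (7.2)] -/
theorem familyLambdaOverhangAll_decided : familyLambdaOverhangAll.Decided :=
  familyLambdaOverhangAll_decided_iff.2 familyLambdaOverhang_decided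

/-- **`R⁺ ++ [(L-b)∣Λ, all worlds]` is decided** (the form the running assembly appends).
[cite: Zhang2022LandauSiegel, §2 (2.32)–(2.33); §7 Prop 7.1 (7.2)] -/
theorem rplus_lambdaOverhangAll_decided : ClassDecided (Rplus ++ [familyLambdaOverhangAll]) :=
  rplus_extend familyLambdaOverhangAll_decided

/-- The verdict unbundled (every hypothesis a binder). [cite: Zhang2022LandauSiegel, §7 Prop 7.1 (7.2)] -/
theorem not_repairable_lambdaOverhang (hK : LambdaOverhangDiagNonneg θ K) (hX : LambdaOverhangCS θ K X)
    (hu : KinkedProfile u u') (hu1 : u 1 = 0) (hL : L.Overhang θ v') (c : ℂ) :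
    ¬ (lambdaBlockMainTerm K X u u' L c < 0) :=
  familyLambdaOverhangAll_decided ⟨θ, u, u', L, v', c⟩ ⟨hu, hu1, hL⟩ K X hK hX

/-- **The class-level reading (the stub's verdict sentence):** the closed family is decided IFF in every world
`(θ, K, X)` carrying the two displayed slots NO member closes — `LambdaOverhangDiagNonneg θ K → LambdaOverhangCS θ K X
→ ¬ ELambdaOverhangCloses θ K X`, which is p461166's `not_eLambdaOverhangCloses_of_cs` (so both sides hold; the
family theorems do not use B-AH). [cite: Zhang2022LandauSiegel, §2 Lemma 2.3, (2.15); §7 Prop 7.1 (7.2)] -/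
theorem familyLambdaOverhangAll_decided_iff_not_closes :
    familyLambdaOverhangAll.Decided ↔
      ∀ (θ : ℝ) (K : LambdaDiag) (X : LambdaCross), LambdaOverhangDiagNonneg θ K → LambdaOverhangCS θ K X →
        ¬ ELambdaOverhangCloses θ K X := by
  constructor
  · rintro h θ K X hK hX ⟨u, u', L, v', c, hu, hu1, hL, hneg⟩
    exact h ⟨θ, u, u', L, v', c⟩ ⟨hu, hu1, hL⟩ K X hK hX hneg
  · intro h d hd K X hK hX hneg
    exact h d.θ K X hK hX ⟨d.u, d.u', d.L, d.v', d.c, hd.kinked, hd.wall, hd.ovh, hneg⟩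

/-- … in particular no world carrying the slots closes (= `KnifeEdge.not_eLambdaOverhangCloses_of_cs`, recovered from
the family). [cite: Zhang2022LandauSiegel, §2 Lemma 2.3, (2.15)] -/
theorem familyLambdaOverhangAll_not_closes (hK : LambdaOverhangDiagNonneg θ K) (hX : LambdaOverhangCS θ K X) :
    ¬ ELambdaOverhangCloses θ K X :=
  familyLambdaOverhangAll_decided_iff_not_closes.1 familyLambdaOverhangAll_decided θ K X hK hX

/-! ### Part 3 — the GRADED twin (fixed amplitude, `𝔞`-graded cross; p462691's currency) -/

section Graded

variable {G : ℝ → LambdaCross}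

/-- **The graded main constant IS a two-block pencil in the amplitude at every coupling value `𝔞`:** bulk block
`𝔅(u)·𝔞` (the `‖s‖²` coefficient), coupling `(G 𝔞)(u,L)`, constant block `K(L)`.
[cite: Zhang2022LandauSiegel, §7 Prop 7.1 (7.2), (2.31)] -/
theorem lambdaGradedMainTerm_eq_twoBlockPencil (K : LambdaDiag) (G : ℝ → LambdaCross) (u u' : ℝ → ℂ)
    (L : LambdaPiece) (s : ℂ) (𝔞 : ℝ) :
    lambdaGradedMainTerm K G u u' L s 𝔞 = twoBlockPencil (mainTermForm u u' * 𝔞) (G 𝔞 u u' L) (K L) s := by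
  unfold lambdaGradedMainTerm twoBlockPencil
  ring

/-- **The CompletedCS-type PSD slot of the GRADED block** (KILL-draft v2.4 §6 «§E target shape»; bare predicate,
asserted for no world): at every coupling value `𝔞 > 0`, on every member of top `θ`,
`|(G 𝔞)(u,L)|² ≤ 𝔅(u)·𝔞·K(L)`. [cite: Zhang2022LandauSiegel, §2 Lemma 2.3, (2.15); (2.31)] -/
def LambdaGradedCS (θ : ℝ) (K : LambdaDiag) (G : ℝ → LambdaCross) : Prop :=
  ∀ (u u' : ℝ → ℂ) (L : LambdaPiece) (v' : ℝ → ℂ), KinkedProfile u u' → u 1 = 0 → L.Overhang θ v' →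
    ∀ 𝔞 : ℝ, 0 < 𝔞 → ‖G 𝔞 u u' L‖ ^ 2 ≤ mainTermForm u u' * 𝔞 * K L

/-- the zero graded cross carries the slot whenever `K ≥ 0` on the class. [cite: Zhang2022LandauSiegel, §7 Prop 7.1 (7.2)] -/
theorem lambdaGradedCS_zero (hK : LambdaOverhangDiagNonneg θ K) : LambdaGradedCS θ K 0 :=
  fun u u' L v' hu _ hL 𝔞 h𝔞 => by
    simpa using mul_nonneg (mul_nonneg (mainTermForm_nonneg_of_isH1 hu.isH1) h𝔞.le) (hK L v' hL)

/-- **The graded certificate:** with `K ≥ 0` on the class and the graded CS slot, the graded main constant of every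
member is `≥ 0` at every amplitude and every coupling value `𝔞 > 0` (`KnifeEdge.twoBlockPencil_nonneg_iff`).
[cite: HornJohnson2013, Thm 7.2.5] -/
theorem lambdaGradedMainTerm_nonneg_of_cs (hK : LambdaOverhangDiagNonneg θ K) (hG : LambdaGradedCS θ K G)
    (hu : KinkedProfile u u') (hu1 : u 1 = 0) (hL : L.Overhang θ v') (s : ℂ) {𝔞 : ℝ} (h𝔞 : 0 < 𝔞) :
    0 ≤ lambdaGradedMainTerm K G u u' L s 𝔞 := by
  rw [lambdaGradedMainTerm_eq_twoBlockPencil]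
  have ha : 0 ≤ mainTermForm u u' * 𝔞 := mul_nonneg (mainTermForm_nonneg_of_isH1 hu.isH1) h𝔞.le
  exact (twoBlockPencil_nonneg_iff ha).2 ⟨hK L v' hL, hG u u' L v' hu hu1 hL 𝔞 h𝔞⟩ s

/-- **… hence no member closes at ANY floor** (p462691's `LambdaGradedClosesAtFloor K G a u u′ L`: some amplitude
with `M(s,𝔞) ≤ −η𝔞`, `η > 0`, for all `𝔞 ≥ a` — impossible at `𝔞 = max a 1 > 0`).
[cite: Zhang2022LandauSiegel, §7 Prop 7.1 (7.2), (2.31)] -/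
theorem not_lambdaGradedClosesAtFloor_of_cs (hK : LambdaOverhangDiagNonneg θ K) (hG : LambdaGradedCS θ K G)
    (hu : KinkedProfile u u') (hu1 : u 1 = 0) (hL : L.Overhang θ v') (a : ℝ) :
    ¬ LambdaGradedClosesAtFloor K G a u u' L := by
  rintro ⟨s, η, hη, hs⟩
  have hpos : 0 < max a 1 := lt_of_lt_of_le one_pos (le_max_right _ _)
  have h1 := hs (max a 1) (le_max_left _ _)
  have h2 := lambdaGradedMainTerm_nonneg_of_cs hK hG hu hu1 hL s hpos
  nlinarith

/-- **A design of the graded currency:** top, in-class profile, Λ-piece (the amplitude is existential inside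
`LambdaGradedClosesAtFloor`). [cite: Zhang2022LandauSiegel, §7 (7.2), (2.31)] -/
structure LambdaGradedDesign where
  /-- the logarithmic top `θ` of the Λ-piece -/
  θ : ℝ
  /-- the in-class `χψ`-smooth side-1 profile -/
  u : ℝ → ℂ
  /-- its marked right derivative -/
  u' : ℝ → ℂ
  /-- the Λ-type piece -/
  L : LambdaPiece
  /-- the marked right derivative of the Λ-profile on `(1, θ)` -/
  v' : ℝ → ℂ

/-- Membership (same binders as `LambdaOverhangDesign.InClass`). [cite: Zhang2022LandauSiegel, §7 (7.2)] -/
structure LambdaGradedDesign.InClass (d : LambdaGradedDesign) : Prop where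
  kinked : KinkedProfile d.u d.u'
  wall : d.u 1 = 0
  ovh : d.L.Overhang d.θ d.v'

/-- **The CLOSED family «(L-b)∣Λ, graded currency, all worlds `(K, G)`»:** verdict = in every graded world
carrying the displayed slots `LambdaOverhangDiagNonneg d.θ K` and `LambdaGradedCS d.θ K G`, the member closes at NO
floor. [cite: Zhang2022LandauSiegel, §7 Prop 7.1 (7.2), (2.31)] -/
def familyLambdaGradedAll : DesignFamily where
  Design := LambdaGradedDesign
  InClass d := d.InClass
  Verdict d := ∀ (K : LambdaDiag) (G : ℝ → LambdaCross), LambdaOverhangDiagNonneg d.θ K → LambdaGradedCS d.θ K G →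
    ∀ a : ℝ, ¬ LambdaGradedClosesAtFloor K G a d.u d.u' d.L

/-- **The graded family is decided.** [cite: Zhang2022LandauSiegel, §7 Prop 7.1 (7.2), (2.31)] -/
theorem familyLambdaGradedAll_decided : familyLambdaGradedAll.Decided :=
  fun _ hd _ _ hK hG a => not_lambdaGradedClosesAtFloor_of_cs hK hG hd.kinked hd.wall hd.ovh a

/-- **`R⁺ ++ [(L-b)∣Λ graded, all worlds]` is decided.** [cite: Zhang2022LandauSiegel, §2 (2.32)–(2.33); §7 Prop 7.1 (7.2)] -/
theorem rplus_lambdaGradedAll_decided : ClassDecided (Rplus ++ [familyLambdaGradedAll]) :=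
  rplus_extend familyLambdaGradedAll_decided

/-- **The graded CS slot is load-bearing on EVERY member:** in the affine world `G 𝔞 = 𝔞•X₁ + 0` with
`X₁ ≡ −(𝔅(u) + 1)` and `K ≡ 0` (diagonal slot satisfied), the member closes at every positive floor at amplitude
`s = 1` (`q₁(1) = 𝔅(u) − 2(𝔅(u)+1) < 0`, `q₀(1) = 0`; p462691's `lambdaGradedClosesAtFloor_of_affine`) — so the
verdict cannot drop `LambdaGradedCS`. [cite: Zhang2022LandauSiegel, §7 Prop 7.1 (7.2), (2.31)] -/
theorem lambdaGradedCross_slot_loadBearing (hu : KinkedProfile u u') (L : LambdaPiece) {a : ℝ} (ha : 0 < a) :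
    ∃ (K : LambdaDiag) (G : ℝ → LambdaCross), LambdaOverhangDiagNonneg θ K ∧
      LambdaGradedClosesAtFloor K G a u u' L := by
  set b : ℝ := mainTermForm u u' with hb
  have hb0 : 0 ≤ b := mainTermForm_nonneg_of_isH1 hu.isH1
  refine ⟨fun _ => 0, affineCross (fun _ _ _ => -((b + 1 : ℝ) : ℂ)) (fun _ _ _ => 0), fun _ _ _ => le_rfl, ?_⟩
  have h1 : gradedCoeffOne (fun _ _ _ => -((b + 1 : ℝ) : ℂ)) u u' L 1 = b - 2 * (b + 1) := by
    unfold gradedCoeffOne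
    rw [← hb]
    simp [Complex.neg_re, Complex.ofReal_re]
    ring
  have h0 : gradedCoeffZero (fun _ => (0:ℝ)) (fun _ _ _ => (0:ℂ)) u u' L 1 = 0 := by
    unfold gradedCoeffZero
    simp
  refine lambdaGradedClosesAtFloor_of_affine ha (s := 1) ?_ ?_
  · rw [h1]; linarith
  · rw [h1, h0]; nlinarith

end Graded

/-! ### Part 4 — C2 (amplitude `0`; disjointness from M2) and C4 (the members of record as data) -/

/-- **C2 — at amplitude `c = 0` the member is its in-class profile alone and the verdict is `R̄`'s positivity
`0 ≤ 𝔅(u)`, UNCONDITIONALLY** — this is E-14's class-free `Repair.lambdaBlock_verdict_zero` (cited, not restated);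
here: the closed family's verdict at amplitude `0` holds in EVERY world, slots or not.
[cite: Zhang2022LandauSiegel, §2 (2.18); §7 Prop 7.1 (7.2)] -/
theorem familyLambdaOverhangAll_verdict_of_amplitude_zero {d : LambdaOverhangDesign} (hu : KinkedProfile d.u d.u')
    (hc : d.c = 0) : familyLambdaOverhangAll.Verdict d := fun K X _ _ => by
  rw [hc]
  exact lambdaBlock_verdict_zero K X hu d.L

/-- **The (L-b)∣Λ class is DISJOINT from B-multi's M2** (`Repair.familyLambdaBlock`): an M2-admissible piece has
`top ≤ 1`, an overhang piece has `top = θ > 1` — same pencil, different class binder (no C2 embedding either way).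
[cite: Zhang2022LandauSiegel, §7 (7.2)] -/
theorem not_admissible_of_overhang (hL : L.Overhang θ v') : ¬ L.Admissible := fun hA => by
  have h1 := hA.top_le
  rw [hL.top_eq] at h1
  exact not_lt.2 h1 hL.one_lt

section Members

/-- **A polynomial Λ-profile on the overhang `[1, θ]`**, zero elsewhere (the shapes of record bump / front / back /
rampcut of BATCH-1v2 are such, with rational coefficients). [cite: Zhang2022LandauSiegel, §7 (7.2) p.44] -/
def polyProf (θ : ℝ) (p : Polynomial ℝ) (z : ℝ) : ℂ :=
  if 1 ≤ z ∧ z ≤ θ then ((p.eval z : ℝ) : ℂ) else 0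

/-- its marked derivative: `p′(z)` on `[1, θ]`, zero elsewhere. [cite: Zhang2022LandauSiegel, §7 (7.2) p.44] -/
def polyProf' (θ : ℝ) (p : Polynomial ℝ) (z : ℝ) : ℂ :=
  if 1 ≤ z ∧ z ≤ θ then (((Polynomial.derivative p).eval z : ℝ) : ℂ) else 0

/-- the Λ-type piece of order `k` and top `θ` with a polynomial profile on `[1,θ]`.
[cite: Zhang2022LandauSiegel, §7 (7.2) p.44] -/
def polyPiece (θ : ℝ) (k : ℕ) (p : Polynomial ℝ) : LambdaPiece := ⟨k, θ, polyProf θ p⟩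

/-- **Every polynomial piece on `[1,θ]` (order `k ≥ 1`, `θ > 1`) is a Λ-piece overhanging to `θ`** — the C4
membership of all 48 polynomial-profile `len-lam-*` rows at once. [cite: Zhang2022LandauSiegel, §7 (7.2) p.44] -/
theorem overhang_polyPiece (hθ : 1 < θ) {k : ℕ} (hk : 1 ≤ k) (p : Polynomial ℝ) :
    (polyPiece θ k p).Overhang θ (polyProf' θ p) := by
  have hcont : Continuous fun z : ℝ => ((p.eval z : ℝ) : ℂ) := Complex.continuous_ofReal.comp p.continuous
  have hcont' : Continuous fun z : ℝ => (((Polynomial.derivative p).eval z : ℝ) : ℂ) :=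
    Complex.continuous_ofReal.comp (Polynomial.derivative p).continuous
  obtain ⟨B, hB⟩ := (isCompact_Icc (a := (1:ℝ)) (b := θ)).exists_bound_of_continuousOn hcont.continuousOn
  obtain ⟨B', hB'⟩ := (isCompact_Icc (a := (1:ℝ)) (b := θ)).exists_bound_of_continuousOn hcont'.continuousOn
  exact
  { order := hk
    top_eq := rfl
    one_lt := hθ
    cont := by
      refine hcont.continuousOn.congr fun z hz => ?_
      simp [polyPiece, polyProf, hz.1, hz.2]
    hasDeriv := by
      intro x hx
      have hd : HasDerivAt (fun z : ℝ => ((p.eval z : ℝ) : ℂ)) ((((Polynomial.derivative p).eval x : ℝ)) : ℂ) x :=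
        (p.hasDerivAt x).ofReal_comp
      have heq : ∀ᶠ z in nhds x, (polyPiece θ k p).prof z = ((p.eval z : ℝ) : ℂ) := by
        filter_upwards [Ioo_mem_nhds hx.1 hx.2] with z hz
        simp [polyPiece, polyProf, hz.1.le, hz.2.le]
      have := (hd.congr_of_eventuallyEq heq).hasDerivWithinAt (s := Ioi x)
      simpa [polyProf', hx.1.le, hx.2.le] using this
    memLp := by
      have hmem : MemLp (fun z : ℝ => (((Polynomial.derivative p).eval z : ℝ) : ℂ)) 2 (volume.restrict (Ioc 1 θ)) :=
        MemLp.of_bound hcont'.aestronglyMeasurable B'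
          (by
            filter_upwards [ae_restrict_mem measurableSet_Ioc] with z hz
            exact hB' z ⟨hz.1.le, hz.2⟩)
      refine hmem.ae_eq ?_
      filter_upwards [ae_restrict_mem measurableSet_Ioc] with z hz
      simp [polyProf', hz.1.le, hz.2]
    vanish := fun y hy => by simp [polyPiece, polyProf, not_le.2 hy]
    vanish' := fun y hy => by simp [polyProf', not_le.2 hy]
    bdd := by
      refine ⟨max B 0, fun z => ?_⟩
      by_cases hz : 1 ≤ z ∧ z ≤ θ
      · have e : (polyPiece θ k p).prof z = ((p.eval z : ℝ) : ℂ) := by simp [polyPiece, polyProf, hz]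
        rw [e]
        exact (hB z ⟨hz.1, hz.2⟩).trans (le_max_left _ _)
      · have e : (polyPiece θ k p).prof z = 0 := by simp [polyPiece, polyProf, hz]
        rw [e, norm_zero]
        exact le_max_right _ _ }

/-- **The bump of record** `4t(1 − t)`, `t = (z − 1)/(θ − 1)`, i.e. `4(z − 1)(θ − z)/(θ − 1)²` (BATCH-1v2 shape
«bump»: at `θ = 5/4` the coefficients `[−80, 144, −64]`). [cite: Zhang2022LandauSiegel, §7 (7.2) p.44] -/
def bumpPoly (θ : ℝ) : Polynomial ℝ :=
  Polynomial.C (4 / (θ - 1) ^ 2) * (Polynomial.X - Polynomial.C 1) * (Polynomial.C θ - Polynomial.X)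

/-- the bump's values. [cite: Zhang2022LandauSiegel, §7 (7.2) p.44] -/
theorem bumpPoly_eval (θ z : ℝ) : (bumpPoly θ).eval z = 4 / (θ - 1) ^ 2 * (z - 1) * (θ - z) := by
  simp [bumpPoly]

/-- at `θ = 5/4` the bump is `−80 + 144z − 64z²` (the design file's coefficient list). [cite: Zhang2022LandauSiegel, §7 (7.2) p.44] -/
theorem bumpPoly_eval_five_fourths (z : ℝ) : (bumpPoly (5/4)).eval z = -80 + 144 * z - 64 * z ^ 2 := by
  rw [bumpPoly_eval]
  ring

/-- **Member of record `len-lam-bump-u{k}-th{θ}` at amplitude `c`:** bulk `ϰ(1, k)` (`k = 5/2` or `3/2`) ⊕ the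
order-1 bump piece on `[1, θ]`. [cite: Zhang2022LandauSiegel, §2 (2.23)–(2.25); §7 (7.2)] -/
def lenLamBump (θ k : ℝ) (c : ℂ) : LambdaOverhangDesign :=
  ⟨θ, kappaP 1 k, kappaP' 1 k, polyPiece θ 1 (bumpPoly θ), polyProf' θ (bumpPoly θ), c⟩

/-- **C4 — the bump members are in the class** for every `θ > 1`, every twist `k`, every amplitude (`ϰ_{1,k}` is a
kinked profile vanishing at `1`: `Repair.kinkedProfile_kappaP`, `Repair.kappaP_one`).
[cite: Zhang2022LandauSiegel, §2 (2.23)–(2.25); §7 (7.2)] -/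
theorem inClass_lenLamBump (hθ : 1 < θ) (k : ℝ) (c : ℂ) : (lenLamBump θ k c).InClass :=
  ⟨kinkedProfile_kappaP one_pos le_rfl, kappaP_one one_pos le_rfl, overhang_polyPiece hθ le_rfl _⟩

/-- … with their verdicts (both knots of record `θ = 5/4`, bulks `ϰ(1,5/2)` / `ϰ(1,3/2)`, shown).
[cite: Zhang2022LandauSiegel, §7 Prop 7.1 (7.2)] -/
theorem verdict_lenLamBump (c : ℂ) :
    familyLambdaOverhangAll.Verdict (lenLamBump (5/4) (5/2) c) ∧
      familyLambdaOverhangAll.Verdict (lenLamBump (5/4) (3/2) c) :=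
  ⟨familyLambdaOverhangAll_decided _ (inClass_lenLamBump (by norm_num) _ c),
    familyLambdaOverhangAll_decided _ (inClass_lenLamBump (by norm_num) _ c)⟩

/-- **Member of record `len-lam-gstar-mv-th{θ}` at amplitude `c` (BATCH-3, kernel mode):** bulk `g⋆`
(`Repair.gStar`, `𝔅(g⋆) = 0`) ⊕ `c·`MV-taper`(θ)` (`KnifeEdge.mvTaperPiece`). [cite: Zhang2022LandauSiegel, §7 (7.2) p.44] -/
def lenLamGstarMV (θ : ℝ) (c : ℂ) : LambdaOverhangDesign := ⟨θ, gStar, gStar', mvTaperPiece θ, mvTaper' θ, c⟩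

/-- **C4 — the kernel-mode members are in the class** for every `θ > 1` (`KnifeEdge.inClassPiece_gStar`,
`KnifeEdge.overhang_mvTaperPiece`). [cite: Zhang2022LandauSiegel, §7 (7.2) p.44] -/
theorem inClass_lenLamGstarMV (hθ : 1 < θ) (c : ℂ) : (lenLamGstarMV θ c).InClass :=
  ⟨inClassPiece_gStar.kinked, inClassPiece_gStar.vanish 1 le_rfl, overhang_mvTaperPiece hθ⟩

/-- … with its verdict. [cite: Zhang2022LandauSiegel, §7 Prop 7.1 (7.2)] -/
theorem verdict_lenLamGstarMV (hθ : 1 < θ) (c : ℂ) : familyLambdaOverhangAll.Verdict (lenLamGstarMV θ c) :=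
  familyLambdaOverhangAll_decided _ (inClass_lenLamGstarMV hθ c)

/-- **The kernel-mode member in a CS world: coupling `0`, block value `|c|²·K(MV_θ) ≥ 0` exactly** (so its
required strength is `0⁺`: `eLambdaOverhangCloses_of_kernelMode`). [cite: Zhang2022LandauSiegel, §7 Prop 7.1 (7.2)] -/
theorem lambdaBlockMainTerm_lenLamGstarMV_of_cs (hθ : 1 < θ) (hX : LambdaOverhangCS θ K X) (c : ℂ) :
    X gStar gStar' (mvTaperPiece θ) = 0 ∧
      lambdaBlockMainTerm K X gStar gStar' (mvTaperPiece θ) c = ‖c‖ ^ 2 * K (mvTaperPiece θ) := by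
  have hx := lambdaOverhangCross_eq_zero_of_kernelMode hX inClassPiece_gStar.kinked
    (inClassPiece_gStar.vanish 1 le_rfl) (overhang_mvTaperPiece hθ) mainTermForm_gStar
  refine ⟨hx, ?_⟩
  rw [lambdaBlockMainTerm, hx, mainTermForm_gStar]
  simp

end Members

/-! ### Part 5 — the slots are inhabited (with equality) and load-bearing on the overhang class -/

/-- **The slots are inhabited, with EQUALITY in the CS slot, on the overhang class** (RepairLambdaBlock's
CS-saturating world `K ≡ 1`, `κ_×(u,L) = √𝔅(u)`): no verdict quantifying over slot-carrying worlds is vacuous, and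
the CS slot cannot be sharpened to a strict inequality; there the pencil TOUCHES zero at `c = −√𝔅(u)`
(`Repair.lambdaBlockMainTerm_saturating_touch`) — the verdict's `¬ (… < 0)` is sharp.
[cite: Zhang2022LandauSiegel, §7 Prop 7.1 (7.2)] -/
theorem saturatingWorld_overhang_slots (θ : ℝ) :
    LambdaOverhangDiagNonneg θ saturatingDiag ∧ LambdaOverhangCS θ saturatingDiag saturatingCross ∧
      ∀ (u u' : ℝ → ℂ) (L : LambdaPiece), KinkedProfile u u' →
        ‖saturatingCross u u' L‖ ^ 2 = mainTermForm u u' * saturatingDiag L :=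
  ⟨fun _ _ _ => zero_le_one, fun u u' L _ hu _ _ => (saturatingWorld_slots.2.2 u u' L hu).le,
    saturatingWorld_slots.2.2⟩

/-- **The CS slot is load-bearing on EVERY member:** for any in-class `u` and any `L` overhanging to `θ` there is
a world with `K ≡ 1 > 0` (diagonal slot satisfied) in which `u ⊕ c·λ` closes — coupling `κ_× ≡ 𝔅(u) + 1`,
indefinite since `𝔅(u)·1 < (𝔅(u)+1)²`. So the verdict cannot drop `LambdaOverhangCS`.
[cite: Zhang2022LandauSiegel, §7 Prop 7.1 (7.2)] -/
theorem lambdaOverhangCross_slot_loadBearing (hu : KinkedProfile u u') (hu1 : u 1 = 0) (hL : L.Overhang θ v') :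
    ∃ (K : LambdaDiag) (X : LambdaCross), LambdaOverhangDiagNonneg θ K ∧
      (∀ L' : LambdaPiece, 0 < K L') ∧ ELambdaOverhangCloses θ K X ∧ ¬ LambdaOverhangCS θ K X := by
  set a : ℝ := mainTermForm u u' with ha
  have ha0 : 0 ≤ a := mainTermForm_nonneg_of_isH1 hu.isH1
  have hind : LambdaOverhangIndefinite θ (fun _ => 1) (fun _ _ _ => ((a + 1 : ℝ) : ℂ)) := by
    refine ⟨u, u', L, v', hu, hu1, hL, ?_⟩
    change mainTermForm u u' * 1 < ‖((a + 1 : ℝ) : ℂ)‖ ^ 2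
    rw [← ha, Complex.norm_real, Real.norm_eq_abs, sq_abs]
    nlinarith
  exact ⟨fun _ => 1, fun _ _ _ => ((a + 1 : ℝ) : ℂ), fun _ _ _ => zero_le_one, fun _ => one_pos,
    eLambdaOverhangCloses_iff_indefinite.2 hind, lambdaOverhangIndefinite_not_cs hind⟩

/-- **Instance on a member of record:** `len-lam-bump-u52-th5:4` closes in such a world (so the slot is load-bearing
on B-len's own design, not only in the abstract). [cite: Zhang2022LandauSiegel, §7 Prop 7.1 (7.2)] -/
theorem lambdaOverhangCross_slot_loadBearing_bump :
    ∃ (K : LambdaDiag) (X : LambdaCross), LambdaOverhangDiagNonneg (5/4) K ∧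
      (∀ L' : LambdaPiece, 0 < K L') ∧ ELambdaOverhangCloses (5/4) K X ∧ ¬ LambdaOverhangCS (5/4) K X :=
  have h := inClass_lenLamBump (θ := 5/4) (by norm_num) (5/2) 0
  lambdaOverhangCross_slot_loadBearing h.kinked h.wall h.ovh

end Repair

end Literature.NumberTheory.LFunctions.Zhang2022
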